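import Summits.NavierStokesRegularity.NavierStokesRegularity.Theorems.CoriolisHeadCounterRotatingLiouvilleCalculus
import Literature.Analysis.FluidPDE.WholeSpaceIBP
import Literature.Analysis.FluidPDE.HessianLaplacian
import Literature.Analysis.FluidPDE.NewtonPotential
import Literature.Analysis.FluidPDE.MildSolutionProofs
import Literature.Analysis.FluidPDE.TsaiMaximumPrinciple
import HarnessLib

/-!
# Route CoriolisHead · crux `NoCoRotatingCore` (stmt-NavierStokesRegularity-22676) —
# weighted energy identity for the damped drift–Laplace equation; the Gaussian weight

Support file (`--supports stmt-NavierStokesRegularity-22676`; theorems only, no definitions, no named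
facts), first half of a Gaussian-weighted energy Liouville theorem
(`CoriolisHeadNoCoRotatingCoreEnergyLiouville`) for the ZERO-FEED spin-vorticity equation

  `L f := νΔf − Df[U − By + ay] = 2a f`        (`L = driftOp ν a (U − B·)`),

`U ∈ C¹(ℝ³; ℝ³)` divergence free, `B` skew (`⟪Bx, x⟫ = 0`), `ν, a > 0`, `f ∈ C²(ℝ³; ℝ)`:

* `weighted_energy_identity` — for every `w ∈ C²_c`, testing the equation against `f w` and
  integrating by parts on the whole space (tree: Green's second identity `integral_mul_laplacian_comm`,
  `∫ θ div V + ∫ ⟪V, ∇θ⟫ = 0`, `div (U − By + ay) = 3a`) gives the exact identity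
  `(a/2) ∫ f² w + ν ∫ w Σᵢ (∂ᵢf)² = ½ ∫ f² (νΔw + Dw[U − By + ay])`;
* `gauss_weight_le` — for the Gaussian `G = e^{−κ|y|²}`, `0 < κ ≤ a/4ν`, `κM² ≤ a²/4` (`|U| ≤ M`),
  POINTWISE `νΔG + DG[U − By + ay] = G(−2κ(a − 2νκ)|y|² − 6νκ − 2κ⟪y, U⟫) ≤ (a/4) G` (`⟪y, By⟫ = 0`:
  the bounded drift is absorbed by the confinement `a y`; this is where `a > 0` enters);
* `exp_neg_mul_sq_poly_le` — the elementary decay `e^{−κR²} (1 + 3R)^m R ≤ (m+1)! 4^m / κ^{m+1}`.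

HONEST FRAMING.  Calculus only; nothing here proves `NoCoRotatingCore`, bounded rotated-profile
Liouville, or Navier–Stokes regularity.

References: T.-P. Tsai, ARMA 143 (1998) 29–51, proof of Lemma 3.1, (3.1) (energy identity against a
cut-off) [Tsai1998]; B. Pineau, V. Vicol, arXiv:2607.09619, §2 (Gaussian-weighted `L²` estimates in
similarity variables) [PineauVicol2026].
-/


noncomputable section

-- the summit and its single sub-problem share the name (CONVENTIONS §1), as in every Theorems file
set_option linter.dupNamespace false

open MeasureTheory Set Function Filter Topology InnerProductSpace Metric
open scoped RealInnerProductSpace Laplacian ContDiff BigOperators ENNReal NNReal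
open Literature.Analysis.FluidPDE

namespace Summit.NavierStokesRegularity.NavierStokesRegularity.Theorems.CoriolisHead


section EnergyIdentity

variable {ν a : ℝ} {B : EuclideanSpace ℝ (Fin 3) →L[ℝ] EuclideanSpace ℝ (Fin 3)}
  {U : EuclideanSpace ℝ (Fin 3) → EuclideanSpace ℝ (Fin 3)} {f : EuclideanSpace ℝ (Fin 3) → ℝ}

/-- `div (U − B· + a·id) = 3a` for a divergence-free `C¹` field `U` and a skew `B` on `ℝ³`. [folklore] -/
theorem divergence_drift_eq (hU : ContDiff ℝ 1 U) (hdiv : VectorCalculus.IsDivFree U)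
    (hB : ∀ x, ⟪B x, x⟫ = 0) (x : EuclideanSpace ℝ (Fin 3)) :
    VectorCalculus.divergence (fun y => U y - B y + a • y) x = 3 * a := by
  have hUd : DifferentiableAt ℝ U x := (hU.differentiable one_ne_zero) x
  have hD : fderiv ℝ (fun y => U y - B y + a • y) x =
      fderiv ℝ U x - B + a • ContinuousLinearMap.id ℝ (EuclideanSpace ℝ (Fin 3)) := by
    have h1 : HasFDerivAt (fun y => U y - B y) (fderiv ℝ U x - B) x :=
      hUd.hasFDerivAt.sub B.hasFDerivAt
    have h2 : HasFDerivAt (fun y : EuclideanSpace ℝ (Fin 3) => a • y)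
        (a • ContinuousLinearMap.id ℝ (EuclideanSpace ℝ (Fin 3))) x :=
      (hasFDerivAt_id x).const_smul a
    exact (h1.add h2).fderiv
  have htr : traceCLM B = 0 := traceCLM_eq_zero_of_skew hB
  rw [divergence_eq_traceCLM, hD, map_add, map_sub, map_smul, ← divergence_eq_traceCLM, hdiv x, htr,
    traceCLM_apply, ContinuousLinearMap.coe_id, LinearMap.trace_id, finrank_euclideanSpace_fin]
  simp only [Nat.cast_ofNat, smul_eq_mul, zero_sub]
  ring

/-- **Weighted energy identity.** If `f ∈ C²(ℝ³)` solves `νΔf − Df[U − By + ay] = 2a f` (`U ∈ C¹`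
divergence free, `B` skew), then for every test weight `w ∈ C²_c(ℝ³)`
`(a/2) ∫ f² w + ν ∫ w Σᵢ (∂ᵢf)² = ½ ∫ f² (νΔw + Dw[U − By + ay])`
(test the equation against `f w`; Green's second identity and `div (U − By + ay) = 3a`).
[cite: Tsai1998, proof of Lemma 3.1 (p. 37)] -/
theorem weighted_energy_identity (hU : ContDiff ℝ 1 U) (hdiv : VectorCalculus.IsDivFree U)
    (hB : ∀ x, ⟪B x, x⟫ = 0) (hf : ContDiff ℝ 2 f)
    (heq : ∀ y, driftOp ν a (fun z => U z - B z) f y = 2 * a * f y)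
    {w : EuclideanSpace ℝ (Fin 3) → ℝ} (hw : ContDiff ℝ 2 w) (hwc : HasCompactSupport w) :
    a / 2 * (∫ x, f x ^ 2 * w x)
        + ν * ∫ x, w x * ∑ i, (fderiv ℝ f x (EuclideanSpace.basisFun (Fin 3) ℝ i)) ^ 2
      = 1 / 2 * ∫ x, f x ^ 2 * (ν * (Δ w) x + fderiv ℝ w x (U x - B x + a • x)) := by
  -- notation and regularity
  set b := EuclideanSpace.basisFun (Fin 3) ℝ with hb
  have hf1 : ContDiff ℝ 1 f := hf.of_le one_le_two
  have hw1 : ContDiff ℝ 1 w := hw.of_le one_le_two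
  have hg2 : ContDiff ℝ 2 fun y => f y * f y := hf.mul hf
  have hV1 : ContDiff ℝ 1 fun y => U y - B y + a • y :=
    (hU.sub B.contDiff).add (contDiff_id.const_smul a)
  have hfc : Continuous f := hf.continuous
  have hwcont : Continuous w := hw.continuous
  have hVc : Continuous fun y => U y - B y + a • y := hV1.continuous
  have hDf : Continuous (fderiv ℝ f) := hf1.continuous_fderiv one_ne_zero
  have hDw : Continuous (fderiv ℝ w) := hw1.continuous_fderiv one_ne_zero
  have hΔf : Continuous (Δ f) := continuous_laplacian hf
  have hΔw : Continuous (Δ w) := continuous_laplacian hw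
  have hfd : ∀ x, HasFDerivAt f (fderiv ℝ f x) x := fun x =>
    ((hf1.differentiable one_ne_zero) x).hasFDerivAt
  have hwd : ∀ x, HasFDerivAt w (fderiv ℝ w x) x := fun x =>
    ((hw1.differentiable one_ne_zero) x).hasFDerivAt
  -- compact supports derived from `w`
  have hΔwc : HasCompactSupport (Δ w) :=
    hwc.mono' fun x hx => by
      contrapose! hx
      exact notMem_support.2 (laplacian_eq_zero_of_notMem_tsupport hx)
  have hDwVc : HasCompactSupport fun x => fderiv ℝ w x (U x - B x + a • x) :=
    hwc.mono' fun x hx => by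
      contrapose! hx
      exact notMem_support.2 (by rw [fderiv_of_notMem_tsupport ℝ hx]; rfl)
  -- integrability of the six integrands (continuous, compactly supported factor)
  have iA : Integrable fun x => f x ^ 2 * w x :=
    ((hfc.pow 2).mul hwcont).integrable_of_hasCompactSupport hwc.mul_left
  have iD : Integrable fun x => w x * ∑ i, (fderiv ℝ f x (b i)) ^ 2 :=
    (hwcont.mul (continuous_finsetSum _ fun i _ => (hDf.clm_apply continuous_const).pow 2))
      |>.integrable_of_hasCompactSupport hwc.mul_right
  have iL : Integrable fun x => f x ^ 2 * (Δ w) x :=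
    ((hfc.pow 2).mul hΔw).integrable_of_hasCompactSupport hΔwc.mul_left
  have iT : Integrable fun x => f x ^ 2 * fderiv ℝ w x (U x - B x + a • x) :=
    ((hfc.pow 2).mul (hDw.clm_apply hVc)).integrable_of_hasCompactSupport hDwVc.mul_left
  have iS : Integrable fun x => w x * (f x * fderiv ℝ f x (U x - B x + a • x)) :=
    (hwcont.mul (hfc.mul (hDf.clm_apply hVc))).integrable_of_hasCompactSupport hwc.mul_right
  have iQ : Integrable fun x => w x * (f x * (Δ f) x) :=
    (hwcont.mul (hfc.mul hΔf)).integrable_of_hasCompactSupport hwc.mul_right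
  -- (1) `Δ(f²) = 2 f Δf + 2 Σᵢ (∂ᵢf)²` and Green's second identity `∫ w Δ(f²) = ∫ Δw f²`
  have hΔsq : ∀ x, (Δ fun y => f y * f y) x =
      2 * (f x * (Δ f) x) + 2 * ∑ i, (fderiv ℝ f x (b i)) ^ 2 := fun x => by
    rw [laplacian_mul_eq b hf hf x, Finset.mul_sum, Finset.mul_sum]
    simp only [sq]
    ring_nf
  have green : ∫ x, w x * (Δ fun y => f y * f y) x = ∫ x, (Δ w) x * (f x * f x) :=
    integral_mul_laplacian_comm hg2 hw hwc
  have hQ : ∫ x, w x * (f x * (Δ f) x) =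
      1 / 2 * (∫ x, f x ^ 2 * (Δ w) x) - ∫ x, w x * ∑ i, (fderiv ℝ f x (b i)) ^ 2 := by
    have h1 : ∫ x, w x * (Δ fun y => f y * f y) x =
        2 * (∫ x, w x * (f x * (Δ f) x)) + 2 * ∫ x, w x * ∑ i, (fderiv ℝ f x (b i)) ^ 2 := by
      have : (fun x => w x * (Δ fun y => f y * f y) x) =
          fun x => 2 * (w x * (f x * (Δ f) x)) + 2 * (w x * ∑ i, (fderiv ℝ f x (b i)) ^ 2) := by
        funext x; rw [hΔsq x]; ring
      rw [this, integral_add (iQ.const_mul 2) (iD.const_mul 2), integral_const_mul, integral_const_mul]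
    have h2 : ∫ x, (Δ w) x * (f x * f x) = ∫ x, f x ^ 2 * (Δ w) x :=
      integral_congr_ae (Eventually.of_forall fun x => by simp only [sq]; ring)
    rw [green, h2] at h1
    linarith
  -- (2) transport: `∫ θ div V + ∫ DΘ[V] = 0` with `θ = w f²`, `div V = 3a`
  have hθ1 : ContDiff ℝ 1 fun x => w x * (f x * f x) := hw1.mul (hf1.mul hf1)
  have hθc : HasCompactSupport fun x => w x * (f x * f x) := hwc.mul_right
  have transport := integral_mul_divergence_add_eq_zero_left hθ1 hV1 hθc
  have hdivV : ∀ x, VectorCalculus.divergence (fun y => U y - B y + a • y) x = 3 * a :=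
    divergence_drift_eq hU hdiv hB
  have hgradθ : ∀ x, ⟪U x - B x + a • x, gradient (fun x => w x * (f x * f x)) x⟫ =
      f x ^ 2 * fderiv ℝ w x (U x - B x + a • x)
        + 2 * (w x * (f x * fderiv ℝ f x (U x - B x + a • x))) := fun x => by
    have hθd : HasFDerivAt (fun x => w x * (f x * f x))
        (w x • (f x • fderiv ℝ f x + f x • fderiv ℝ f x) + (f x * f x) • fderiv ℝ w x) x :=
      (hwd x).mul ((hfd x).mul (hfd x))
    rw [gradient, real_inner_comm, InnerProductSpace.toDual_symm_apply, hθd.fderiv]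
    simp only [_root_.add_apply, _root_.FunLike.coe_smul, Pi.smul_apply, smul_eq_mul, sq]
    ring
  have hS : 3 * a * (∫ x, f x ^ 2 * w x) + (∫ x, f x ^ 2 * fderiv ℝ w x (U x - B x + a • x))
      + 2 * ∫ x, w x * (f x * fderiv ℝ f x (U x - B x + a • x)) = 0 := by
    have h1 : ∫ x, (w x * (f x * f x)) * VectorCalculus.divergence (fun y => U y - B y + a • y) x =
        3 * a * ∫ x, f x ^ 2 * w x := by
      rw [← integral_const_mul]
      refine integral_congr_ae (Eventually.of_forall fun x => ?_)
      simp only [hdivV x, sq]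
      ring
    have h2 : ∫ x, ⟪U x - B x + a • x, gradient (fun x => w x * (f x * f x)) x⟫ =
        (∫ x, f x ^ 2 * fderiv ℝ w x (U x - B x + a • x))
          + 2 * ∫ x, w x * (f x * fderiv ℝ f x (U x - B x + a • x)) := by
      simp_rw [hgradθ]
      rw [integral_add iT (iS.const_mul 2), integral_const_mul]
    rw [h1, h2] at transport
    linarith
  -- (3) the equation, tested against `w f`
  have hE : ν * (∫ x, w x * (f x * (Δ f) x)) =
      (∫ x, w x * (f x * fderiv ℝ f x (U x - B x + a • x))) + 2 * a * ∫ x, f x ^ 2 * w x := by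
    have hpt : ∀ x, ν * (w x * (f x * (Δ f) x)) =
        w x * (f x * fderiv ℝ f x (U x - B x + a • x)) + 2 * a * (f x ^ 2 * w x) := fun x => by
      have h := heq x
      simp only [driftOp] at h
      have : ν * (Δ f) x = fderiv ℝ f x (U x - B x + a • x) + 2 * a * f x := by linarith
      linear_combination (w x * f x) * this
    rw [← integral_const_mul, ← integral_const_mul, ← integral_add iS (iA.const_mul _)]
    exact integral_congr_ae (Eventually.of_forall hpt)
  -- (4) assemble
  have hsplit : ∫ x, f x ^ 2 * (ν * (Δ w) x + fderiv ℝ w x (U x - B x + a • x)) =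
      ν * (∫ x, f x ^ 2 * (Δ w) x) + ∫ x, f x ^ 2 * fderiv ℝ w x (U x - B x + a • x) := by
    rw [← integral_const_mul, ← integral_add (iL.const_mul _) iT]
    exact integral_congr_ae (Eventually.of_forall fun x => by ring)
  rw [hsplit]
  rw [hQ] at hE
  linarith

end EnergyIdentity

section Liouville

variable {ν a : ℝ} {B : EuclideanSpace ℝ (Fin 3) →L[ℝ] EuclideanSpace ℝ (Fin 3)}
  {U : EuclideanSpace ℝ (Fin 3) → EuclideanSpace ℝ (Fin 3)} {f : EuclideanSpace ℝ (Fin 3) → ℝ}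

/-- **The Gaussian is a strict supersolution of the adjoint drift operator, up to `a/4`.** For
`G = e^{−κ|y|²}` with `0 < κ ≤ a/(4ν)` and `κ M² ≤ a²/4` (`|U| ≤ M`, `B` skew, `ν, a > 0`):
`νΔG + DG[U − By + ay] = G (4νκ²|y|² − 6νκ − 2κ⟪y, U⟫ − 2κa|y|²) ≤ (a/4) G`
(`⟪y, By⟫ = 0`; complete the square in `|y|`). [folklore] -/
theorem gauss_weight_le (hν : 0 < ν) (ha : 0 < a) (hB : ∀ x, ⟪B x, x⟫ = 0) {M : ℝ}
    (hM : ∀ y, ‖U y‖ ≤ M) {κ : ℝ} (hκ0 : 0 < κ) (hκ1 : κ ≤ a / (4 * ν))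
    (hκ2 : κ * M ^ 2 ≤ a ^ 2 / 4) (y : EuclideanSpace ℝ (Fin 3)) :
    ν * (Δ (gaussProfile (-κ) : EuclideanSpace ℝ (Fin 3) → ℝ)) y
        + fderiv ℝ (gaussProfile (-κ) : EuclideanSpace ℝ (Fin 3) → ℝ) y (U y - B y + a • y)
      ≤ a / 4 * gaussProfile (-κ) y := by
  have hG : 0 < gaussProfile (-κ) y := Real.exp_pos _
  have hΔ : (Δ (gaussProfile (-κ) : EuclideanSpace ℝ (Fin 3) → ℝ)) y
      = (4 * κ ^ 2 * ‖y‖ ^ 2 - 6 * κ) * gaussProfile (-κ) y := by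
    rw [laplacian_gaussProfile, finrank_euclideanSpace_fin]
    push_cast
    ring
  have hyB : ⟪y, B y⟫ = 0 := by rw [real_inner_comm]; exact hB y
  have hD : fderiv ℝ (gaussProfile (-κ) : EuclideanSpace ℝ (Fin 3) → ℝ) y (U y - B y + a • y)
      = -(2 * κ) * gaussProfile (-κ) y * (⟪y, U y⟫ + a * ‖y‖ ^ 2) := by
    rw [fderiv_gaussProfile_apply, inner_add_right, inner_sub_right, hyB, real_inner_smul_right,
      real_inner_self_eq_norm_sq]
    ring
  rw [hΔ, hD]
  have h4 : 4 * ν * κ ≤ a := by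
    have := (le_div_iff₀ (by positivity : (0 : ℝ) < 4 * ν)).1 hκ1
    linarith
  have key : ν * (4 * κ ^ 2 * ‖y‖ ^ 2 - 6 * κ) + -(2 * κ) * (⟪y, U y⟫ + a * ‖y‖ ^ 2)
      ≤ a / 4 := by
    have ht : 0 ≤ ‖y‖ := norm_nonneg y
    have hin : -⟪y, U y⟫ ≤ ‖y‖ * M := by
      have h1 := abs_real_inner_le_norm y (U y)
      have h2 := neg_le_abs ⟪y, U y⟫
      have h3 : ‖y‖ * ‖U y‖ ≤ ‖y‖ * M := mul_le_mul_of_nonneg_left (hM y) ht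
      linarith
    have e1 : ν * (4 * κ ^ 2 * ‖y‖ ^ 2) ≤ κ * a * ‖y‖ ^ 2 := by
      have h4' : ν * (4 * κ ^ 2) ≤ κ * a := by
        have := mul_le_mul_of_nonneg_left h4 hκ0.le
        linarith [show κ * (4 * ν * κ) = ν * (4 * κ ^ 2) by ring]
      calc ν * (4 * κ ^ 2 * ‖y‖ ^ 2) = ν * (4 * κ ^ 2) * ‖y‖ ^ 2 := by ring
        _ ≤ κ * a * ‖y‖ ^ 2 := mul_le_mul_of_nonneg_right h4' (sq_nonneg _)
    have e2 : -(2 * κ) * ⟪y, U y⟫ ≤ 2 * κ * (‖y‖ * M) := by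
      have := mul_le_mul_of_nonneg_left hin (by positivity : (0 : ℝ) ≤ 2 * κ)
      linarith
    have e3 : -(κ * a * ‖y‖ ^ 2) + 2 * κ * (‖y‖ * M) ≤ κ * M ^ 2 / a := by
      have hsq : 0 ≤ κ * a * (‖y‖ - M / a) ^ 2 := by positivity
      have hexp : κ * a * (‖y‖ - M / a) ^ 2
          = κ * a * ‖y‖ ^ 2 - 2 * κ * (‖y‖ * M) + κ * M ^ 2 / a := by
        field_simp
        ring
      linarith
    have e4 : κ * M ^ 2 / a ≤ a / 4 := by
      rw [div_le_iff₀ ha]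
      linarith [show a ^ 2 / 4 = a / 4 * a by ring]
    have e5 : 0 ≤ ν * κ := by positivity
    linarith
  have := mul_le_mul_of_nonneg_left key hG.le
  linarith

/-- Elementary decay: `e^{−κR²} (1 + 3R)^m R ≤ (m+1)! 4^m / κ^{m+1}` for `R ≥ 1`, `κ > 0`
(`e^{s} ≥ s^{m+1}/(m+1)!` with `s = κR²`). [folklore] -/
theorem exp_neg_mul_sq_poly_le {κ R : ℝ} (hκ : 0 < κ) (hR : 1 ≤ R) (m : ℕ) :
    Real.exp (-κ * R ^ 2) * (1 + 3 * R) ^ m * R ≤ (m + 1).factorial * 4 ^ m / κ ^ (m + 1) := by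
  have hR0 : 0 < R := by linarith
  have hs : 0 < κ * R ^ 2 := by positivity
  -- `e^{-s} ≤ (m+1)!/s^{m+1}`
  have h1 : Real.exp (-κ * R ^ 2) ≤ (m + 1).factorial / (κ * R ^ 2) ^ (m + 1) := by
    have h := Real.pow_div_factorial_le_exp (x := κ * R ^ 2) hs.le (m + 1)
    rw [div_le_iff₀ (by positivity)] at h
    rw [show -κ * R ^ 2 = -(κ * R ^ 2) by ring, Real.exp_neg, inv_eq_one_div,
      div_le_div_iff₀ (Real.exp_pos _) (by positivity), one_mul]
    linarith
  -- `(1+3R)^m ≤ (4R)^m`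
  have h2 : (1 + 3 * R) ^ m ≤ (4 * R) ^ m :=
    pow_le_pow_left₀ (by positivity) (by linarith) m
  have h3 : R ^ (m + 1) ≤ R ^ (2 * (m + 1)) := pow_le_pow_right₀ hR (by omega)
  have hfin : (m + 1).factorial / (κ * R ^ 2) ^ (m + 1) * (4 * R) ^ m * R
      = (m + 1).factorial * 4 ^ m / κ ^ (m + 1) * (R ^ (m + 1) / R ^ (2 * (m + 1))) := by
    rw [mul_pow, mul_pow, ← pow_mul, pow_succ R m]
    field_simp
  calc Real.exp (-κ * R ^ 2) * (1 + 3 * R) ^ m * R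
      ≤ (m + 1).factorial / (κ * R ^ 2) ^ (m + 1) * (4 * R) ^ m * R := by
        gcongr
    _ = (m + 1).factorial * 4 ^ m / κ ^ (m + 1) * (R ^ (m + 1) / R ^ (2 * (m + 1))) := hfin
    _ ≤ (m + 1).factorial * 4 ^ m / κ ^ (m + 1) * 1 := by
        gcongr
        exact (div_le_one (by positivity)).2 h3
    _ = (m + 1).factorial * 4 ^ m / κ ^ (m + 1) := mul_one _

end Liouville

end Summit.NavierStokesRegularity.NavierStokesRegularity.Theorems.CoriolisHead

end
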